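import Summits.CriticalPhenomena.SAWScalingLimit.Theorems.MassRatio.Negative.RowsA
import Literature.Probability.RandomPlanarGeometry.HexSAWBridgeDecay

/-!
# Objects of the line `renewal-averaging-at-b` for the crux `SAWDefectDecoherence.MassRatio`
(stmt-CriticalPhenomena-8550; lead prover, crux protocol; skeleton
`Summits/CriticalPhenomena/SAWScalingLimit/Cruxes/MassRatio/Lines/renewal_averaging_at_b.lean`)

The crux compares, in the frame of `MassRatio` (Dobrushin domain flat near `b` on `B(b,ρ)`,
admissible discretisations `Λ_δ` with the ROWS CLAUSE inside `B(b,ρ)`), the averaged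
boundary-to-bulk mass `δ² Σ_{e ∈ K} Z_δ(a_δ → e)` with the boundary-to-boundary point mass
`Z_δ(a_δ → b_δ)` at the cut `δ^{-3/4}`.  The line reads the walks `a_δ → b_δ` backwards from the
boundary POINT `b_δ`: inside `B(b,ρ)` the rows clause makes `Λ_δ` the exact half-lattice
`{row ≥ m}` and `b_δ` a DOOR edge; cutting each walk at its entrance into a window BOX standing on
the door, at the first level `h ∈ [t,2t]` that is a renewal level (in Kesten's sense) of the final
box-confined piece, is injective and weight-multiplicative, and the total mass of the renewal
KERNEL is controlled by one-dimensional renewal theory on the explicit sequence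
`T ↦ B_T = HV.stripBlim T` of Duminil-Copin–Smirnov strip bridges.

This file only DEFINES the finite lattice objects the line's registered stubs speak about, so that
the stub files under `Theorems/` and the line's final file share one vocabulary — no statement of
the line is asserted here:

* `Z`, `door`, `box`, `top` — the spin-`0` mass and the brick-coordinate geometry of the window
  (`row/pos/bv/Rect` of `Theorems/MassRatio/Negative/{Brick,RowsA}`);
* `Splits`, `NoSplit`, `kernel`, `boxMass`, `cutSum` — renewal levels of box-confined walks read
  from the top edge down to the door, the renewal kernel `κ_t(h,j)`, its block mass, and the
  kernel-weighted cut sum of point masses of the shaved domains `Λ ∖ box_h`;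
* `Kernel`, `bridgeMassOf`, `irrMassOf`, `boxMassOf` — for an arbitrary box kernel `κ`: bridges of
  height `h` (`t = h`), irreducible ones (`t = 1`), block mass — the sequences of Kesten's renewal
  structure (`boxMassOf kernel = boxMass` by `rfl`);
* `BridgeDictionary κ B`, `RenewalSurgery κ`, `BoxMassFloor M` — the PREDICATES of the b-side module
  (translation invariance + identification of `sup_W` bridges with `B = HV.stripBlim`; the two
  finite concatenation / splitting inequalities; the conclusion "the block mass is bounded below"),
  instantiated by the stubs at `κ = kernel`, `M = boxMass`;
* `rho0`, `tOf` — the macroscopic scale of the window and the lattice height scale of the glue;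
* `kernel_nonneg` — the one trivial registered sub-goal proved here.

Sources: H. Kesten, J. Math. Phys. 4 (1963) 960–969 (irreducible bridges); N. Madras, G. Slade,
*The Self-Avoiding Walk* (1993) §4.2 (bridge renewal); H. Duminil-Copin, S. Smirnov, Ann. of Math.
175 (2012) (arXiv:1007.0575) §3 (strip bridges `B_{T,L}`); the line card
`Cruxes/MassRatio/Lines/renewal-averaging-at-b.md`.  Deliberately NOT here: the stub statements
proper (renewal cut, `RenewalBlock`, lateral confinement, arc mass ratio) and any theorem beyond `kernel_nonneg`.
-/

noncomputable section

namespace Summit.CriticalPhenomena.SAWScalingLimit.Theorems.MassRatio.Renewal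

open Literature.Probability.LatticeModels Literature.Probability.RandomPlanarGeometry
open Literature.Probability.RandomPlanarGeometry.SAW
open Summit.CriticalPhenomena.SAWScalingLimit.Theorems.MassRatio.Negative

/-! ### The mass and the window geometry -/

/-- The critical two-point mass `Z_Λ(a → z) = ‖F_{x_c,0}(z)‖ = Σ_{γ ⊂ Λ : a → z} x_c^{ℓ(γ)}`
(spin `0`: a sum of nonnegative reals, `Negative.norm_Z_eq_sum`). [folklore] -/
def Z (Λ : Finset HexVertex) (a z : Sym2 HexVertex) : ℝ :=
  ‖hexParafermionicObservable Λ a hexCriticalFugacity 0 z‖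

/-- The door edge below `(m, p)`: the vertical mid-edge `{(m-1, p), (m, p)}` in brick coordinates
(`bv`); a boundary mid-edge of the exact half-lattice `{row ≥ m}` when `(p - m) % 2 = 0`.
[folklore] -/
def door (m p : ℤ) : Sym2 HexVertex := s(bv (m - 1) p, bv m p)

/-- The window box of height `h` and half-width `W` standing on the door at `(m, p)`:
rows `m … m+h-1`, positions `p-W … p+W`. [folklore] -/
def box (m p : ℤ) (h W : ℕ) : Finset HexVertex := Rect m (m + h - 1) (p - W) (p + W)

/-- The vertical mid-edge through the top of `box m p h W` at lateral offset `j`: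
`{(m+h, p+j), (m+h-1, p+j)}` (an edge of `ℍ` iff `(p + j - (m + h)) % 2 = 0`). [folklore] -/
def top (m p : ℤ) (h : ℕ) (j : ℤ) : Sym2 HexVertex := s(bv (m + h) (p + j), bv (m + h - 1) (p + j))

/-! ### Renewal levels, the kernel, block mass and cut sum -/

/-- A vertex list SPLITS at level `h'` above row `m`: it is a (possibly trivial) initial segment
at rows `≥ m + h'` followed by a final segment at rows `< m + h'` — for box walks read from the top
edge down to the door, `m + h'` is a RENEWAL LEVEL in Kesten's sense. [folklore] -/
def Splits (m : ℤ) (h' : ℕ) (l : List HexVertex) : Prop :=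
  ∃ l₁ l₂ : List HexVertex, l = l₁ ++ l₂ ∧ (∀ v ∈ l₁, m + h' ≤ row v) ∧ (∀ v ∈ l₂, row v < m + h')

/-- No renewal level in `[t, h)`. [folklore] -/
def NoSplit (m : ℤ) (t h : ℕ) (l : List HexVertex) : Prop :=
  ∀ h' : ℕ, t ≤ h' → h' < h → ¬ Splits m h' l

open scoped Classical in
/-- **The renewal kernel** `κ_t(h, j)`: the `x_c`-mass of the self-avoiding walks INSIDE
`box m p h W` from its top mid-edge at offset `j` down to the door at `(m, p)` having no renewal
level in `[t, h)` (reversed: Kesten prefixes of height exactly `h` whose first renewal level `≥ t`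
is `h`, laterally confined to `|pos - p| ≤ W`). A `δ`-free lattice quantity. [folklore] -/
def kernel (m p : ℤ) (t W h : ℕ) (j : ℤ) : ℝ :=
  ∑ β : HexMidEdgeSAW (box m p h W) (top m p h j) (door m p),
    if NoSplit m t h β.verts then hexCriticalFugacity ^ β.length else 0

/-- **Block mass** `Σ_{h ∈ [t,2t]} Σ_{|j| ≤ W} κ_t(h, j)`. [folklore] -/
def boxMass (m p : ℤ) (t W : ℕ) : ℝ :=
  ∑ h ∈ Finset.Icc t (2 * t), ∑ j ∈ Finset.Icc (-(W : ℤ)) W, kernel m p t W h j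

/-- **Cut sum**: the `κ`-weighted sum of the point masses from the root `a` to the top mid-edges of
the shaved domains `Λ \ box_h`. [folklore] -/
def cutSum (Λ : Finset HexVertex) (a : Sym2 HexVertex) (m p : ℤ) (t W : ℕ) : ℝ :=
  ∑ h ∈ Finset.Icc t (2 * t), ∑ j ∈ Finset.Icc (-(W : ℤ)) W,
    Z (Λ \ box m p h W) a (top m p h j) * kernel m p t W h j

/-! ### Bridges and irreducible bridges of a kernel -/

/-- A **box kernel**: a real function of (door row `m`, door position `p`, renewal threshold `t`,
window `W`, height `h`, top offset `j`) — the shape of `kernel`; the b-side module is stated for an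
arbitrary kernel `κ` and instantiated at `κ = kernel`. [folklore] -/
abbrev Kernel : Type := ℤ → ℤ → ℕ → ℕ → ℕ → ℤ → ℝ

/-- **Bridges of height `h`** of the kernel `κ`: `Σ_{|j| ≤ W} κ(m,p; t = h, W, h, j)` — for
`κ = kernel` the `x_c`-mass of ALL walks inside `box m p h W` from a top mid-edge down to the door
(`NoSplit m h h` is vacuous); at the door `(0,0)` these are, up to reversal and the coordinate
dictionary `hvIso`, the Duminil-Copin–Smirnov strip bridges counted by `B_{h,L}`, laterally
confined. [folklore] -/
def bridgeMassOf (κ : Kernel) (m p : ℤ) (h W : ℕ) : ℝ :=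
  ∑ j ∈ Finset.Icc (-(W : ℤ)) W, κ m p h W h j

/-- **Irreducible bridges of height `h`** (Kesten) of the kernel `κ`: `Σ_{|j| ≤ W} κ(m,p; t = 1, W, h, j)`
— for `κ = kernel`, box walks with no renewal level in `[1, h)`. [folklore] -/
def irrMassOf (κ : Kernel) (m p : ℤ) (h W : ℕ) : ℝ :=
  ∑ j ∈ Finset.Icc (-(W : ℤ)) W, κ m p 1 W h j

/-- **Block mass** of the kernel `κ`: `Σ_{h ∈ [t,2t]} Σ_{|j| ≤ W} κ(m,p; t, W, h, j)`;
`boxMassOf kernel = boxMass` by `rfl`. [folklore] -/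
def boxMassOf (κ : Kernel) (m p : ℤ) (t W : ℕ) : ℝ :=
  ∑ h ∈ Finset.Icc t (2 * t), ∑ j ∈ Finset.Icc (-(W : ℤ)) W, κ m p t W h j

/-! ### Statements of the b-side module (predicates; asserted nowhere in this file) -/

/-- **Bridge dictionary** for a kernel `κ` and a sequence `B` (used at `κ = kernel`,
`B = HV.stripBlim`): (i) `κ` is invariant under door translations `(m,p) ↦ (0,0)` with
`(p - m) % 2 = 0` (a lattice automorphism); (ii) monotone in the window `W`; (iii) its bridges at
the door `(0,0)` are bounded by `B_h`; (iv) and approximate `B_h` from below as `W → ∞` (boxes and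
DCS trapezoids `S_{h,L}` are mutually cofinal); (v) `κ` vanishes when the top mid-edge
`top m p h j` is not an edge of `ℍ`, i.e. when `(p + j - (m + h)) % 2 ≠ 0`. [folklore] -/
def BridgeDictionary (κ : Kernel) (B : ℕ → ℝ) : Prop :=
  (∀ (m p : ℤ) (t W h : ℕ) (j : ℤ), (p - m) % 2 = 0 → κ m p t W h j = κ 0 0 t W h j) ∧
  (∀ (m p : ℤ) (t W W' h : ℕ) (j : ℤ), W ≤ W' → κ m p t W h j ≤ κ m p t W' h j) ∧
  (∀ (h W : ℕ), 1 ≤ h → bridgeMassOf κ 0 0 h W ≤ B h) ∧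
  (∀ (h : ℕ), 1 ≤ h → ∀ ε : ℝ, 0 < ε → ∃ W : ℕ, B h - ε ≤ bridgeMassOf κ 0 0 h W) ∧
  (∀ (m p : ℤ) (t W h : ℕ) (j : ℤ), (p + j - (m + h)) % 2 ≠ 0 → κ m p t W h j = 0)

/-- **Renewal surgery** for a kernel `κ` (used at `κ = kernel`): the two finite inequalities of
Kesten's bridge decomposition in the box, windows doubling. (A) CONCATENATION: an irreducible
bridge of height `h - k` stacked on a bridge of height `k < t` (or an irreducible bridge of full
height `h`) is a box walk of height `h` with no renewal level in `[t, h)`, injectively;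
(B) SPLITTING at the HIGHEST renewal level: a bridge of height `s` is irreducible or splits
uniquely into a lower bridge of height `k` and an irreducible upper bridge of height `s - k`.
Doors of the upper pieces are written translated (no invariance presupposed). [folklore] -/
def RenewalSurgery (κ : Kernel) : Prop :=
  (∀ (m p : ℤ) (t V h : ℕ), (p - m) % 2 = 0 → 1 ≤ t → t ≤ h →
    irrMassOf κ m p h V + ∑ k ∈ Finset.Icc 1 (t - 1), ∑ j ∈ Finset.Icc (-(V : ℤ)) V,
        κ m p k V k j * irrMassOf κ (m + k) (p + j) (h - k) V
      ≤ ∑ j ∈ Finset.Icc (-((2 * V : ℕ) : ℤ)) ((2 * V : ℕ) : ℤ), κ m p t (2 * V) h j) ∧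
  (∀ (m p : ℤ) (s W : ℕ), (p - m) % 2 = 0 → 1 ≤ s →
    bridgeMassOf κ m p s W ≤ irrMassOf κ m p s W +
      ∑ k ∈ Finset.Icc 1 (s - 1), ∑ j ∈ Finset.Icc (-(W : ℤ)) W,
        κ m p k W k j * irrMassOf κ (m + k) (p + j) (s - k) (2 * W))

/-- **Block-mass floor** for a block-mass function `M` (used at `M = boxMass`; the conclusion of
the b-side module): a uniform positive lower bound at every large scale `t`, for some window
`W = W(t)`, at every door. [folklore] -/
def BoxMassFloor (M : ℤ → ℤ → ℕ → ℕ → ℝ) : Prop :=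
  ∃ p₁ : ℝ, 0 < p₁ ∧ ∃ t₁ : ℕ, ∀ t : ℕ, t₁ ≤ t → ∃ W : ℕ, ∀ m p : ℤ, (p - m) % 2 = 0 →
    p₁ ≤ M m p t W

/-! ### Scales of the glue -/

/-- The macroscopic scale of the window: `ρ₀ = min ρ ‖a - b‖` (the box must sit inside the rigid
half-disc `B(b, ρ)` AND stay away from the root `a = D.pt 0`). [folklore] -/
def rho0 (D : DobrushinDomain) (ρ : ℝ) : ℝ := min ρ (dist (D.pt 0) (D.pt 1))

/-- The lattice height scale `t(δ) = ⌊ρ₀ / (32 A δ)⌋`: the box of height `2t` and half-width `A t`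
has scaled diameter `< ρ₀ / 4`. [folklore] -/
def tOf (D : DobrushinDomain) (ρ : ℝ) (A : ℕ) (δ : ℝ) : ℕ := ⌊rho0 D ρ / (32 * (A : ℝ) * δ)⌋₊

/-! ### Trivial API (registered sub-goal, so that this vocabulary file supports the crux item) -/

/-- The renewal kernel is nonnegative (a sum of powers of `x_c > 0` and zeros). [folklore] -/
theorem kernel_nonneg : ∀ (m p : ℤ) (t W h : ℕ) (j : ℤ), 0 ≤ kernel m p t W h j := by
  intro m p t W h j
  unfold kernel
  refine Finset.sum_nonneg fun β _ => ?_
  split_ifs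
  · exact pow_nonneg hexCriticalFugacity_pos_lt_one.1.le _
  · exact le_rfl

end Summit.CriticalPhenomena.SAWScalingLimit.Theorems.MassRatio.Renewal
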